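import Mathlib
import Summits.ValiantsHypothesis.ValiantsHypothesis.Theorems.NewtonUnitEquationsTwoProductsConeChart
import Summits.ValiantsHypothesis.ValiantsHypothesis.Theorems.NewtonUnitEquationsTwoProductsFormalLogLinearisationDefs
import Summits.ValiantsHypothesis.ValiantsHypothesis.Theorems.NewtonUnitEquationsTwoProductsFormalLogLinearisationChartTools
import HarnessLib

/-!
# Route NewtonUnitEquations — crux `TwoProducts` (stmt-ValiantsHypothesis-5906), line `formal-log-linearisation`:
# the STRUCTURED chart normalisation (local tails are chart images of the relative tails)

Registered line `Cruxes/TwoProducts/Lines/formal-log-linearisation.lean` (NOT the item's skeleton of record; helper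
mode). Its stub 2 `stub_chartNormalisation` (landed, `…StubChartNormalisation.lean`, p3 g12) produces, for a
cancelling top-assignment `(a, b)` of a `t`-sparse instance `(f, g)`, SOME normalised instance `(u, v)` with
`#hidden(a,b) ≤ #visible(u,v)` — but its statement forgets HOW `(u, v)` arises from `(f, g)`, so no structural
hypothesis on the supports of the factors (common tail cone, rays, collinear tails, …) can be passed to the local
problem, and the corner-log line's LOCAL engine rungs (`CommonCone`, `RayFactors`, `Collinear`, `Homogeneous`,
`Pencil`, …) cannot be turned into GLOBAL partial ranges of the crux. This file states and proves the structured
form (same construction as the landed stub 2 — an adapted integer chart with rows `r₁, r₂`, `det ≠ 0`, over the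
corner-log chart engine `TwoProducts.ConeChart.cc_*` and the line's `…ChartTools`):

* `chartNormalisation_structured` — for every cancelling `(a, b)` there are integer rows `r₁, r₂` with
  `r₁ 0 * r₂ 1 ≠ r₁ 1 * r₂ 0` and a normalised instance `(u, v)` (zero constant terms, `≤ t − 1` monomials) with
  `#hidden(a,b) ≤ #visible(u,v)` such that EVERY TAIL MONOMIAL IS A CHART IMAGE OF A RELATIVE TAIL: for each
  `d ∈ supp u_j` there is `p ∈ supp f_j`, `p ≠ a_j`, with `d_k = r_k · (p − a_j)` (`k = 1, 2`), and likewise for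
  `v_j`, `g_j`, `b_j`.

Consequently any hypothesis of the shape "`supp f_j ⊆ a_j + T_j`" descends to "`supp u_j ⊆ r(T_j ∖ 0)`" with the
SAME linear map `r` for all `2m` factors. First consumer: `Theorems/NewtonUnitEquationsTwoProductsCommonShapeTrinomials.lean`
(pencils of common-shape trinomials, via the common-cone rung `engineCommonConeRung`).

Honest framing: transport lemma on a registered non-record line; the engine `stub_logSumEngine` and the crux
`TwoProducts` stay OPEN; nothing here is progress on `VP ≠ VNP` (NOT proved). No definitions, no named facts. The
proof is the landed stub 2's (p3 g12), re-run with the chart exposed.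
-/

set_option linter.dupNamespace false

noncomputable section

open scoped BigOperators
open MvPolynomial

namespace Summit.ValiantsHypothesis.ValiantsHypothesis.Theorems.NewtonUnitEquations.TwoProducts.FormalLogLinearisation

variable {m : ℕ}

/-- Coordinates of a charted tail: if `d = Ψ_μ p` with `L μ ≤ L p` for the chart `L` with rows `r₁, r₂`, then
`d_k = r_k · (p − μ)`. [folklore] -/
theorem psi_coord_eq (L : Expo →+ (Fin 2 → ℤ)) (r₁ r₂ : Fin 2 → ℤ)
    (hL0 : ∀ e, L e 0 = r₁ 0 * ((e 0 : ℕ) : ℤ) + r₁ 1 * ((e 1 : ℕ) : ℤ))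
    (hL1 : ∀ e, L e 1 = r₂ 0 * ((e 0 : ℕ) : ℤ) + r₂ 1 * ((e 1 : ℕ) : ℤ)) (μ p : Expo) (h : L μ ≤ L p) :
    (((Finsupp.equivFunOnFinite.symm fun i => (L p i - L μ i).toNat : Expo) 0 : ℕ) : ℤ) =
        r₁ 0 * (((p 0 : ℕ) : ℤ) - ((μ 0 : ℕ) : ℤ)) + r₁ 1 * (((p 1 : ℕ) : ℤ) - ((μ 1 : ℕ) : ℤ)) ∧
      (((Finsupp.equivFunOnFinite.symm fun i => (L p i - L μ i).toNat : Expo) 1 : ℕ) : ℤ) =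
        r₂ 0 * (((p 0 : ℕ) : ℤ) - ((μ 0 : ℕ) : ℤ)) + r₂ 1 * (((p 1 : ℕ) : ℤ) - ((μ 1 : ℕ) : ℤ)) := by
  have h0 := TwoProducts.ConeChart.cc_psi_apply L μ p h 0
  have h1 := TwoProducts.ConeChart.cc_psi_apply L μ p h 1
  rw [hL0, hL0] at h0
  rw [hL1, hL1] at h1
  constructor
  · rw [h0]; ring
  · rw [h1]; ring

/-- **STRUCTURED chart normalisation.** For a cancelling top-assignment `(a, b)` of a `t`-sparse instance `(f, g)`
there are integer rows `r₁, r₂` (`det ≠ 0`) and a normalised instance `(u, v)` (zero constant terms, `≤ t − 1`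
monomials a side) with `#hidden(a,b) ≤ #visible(u,v)`, every monomial `d` of `u_j` (resp. `v_j`) being the chart
image `d_k = r_k · (p − a_j)` of a support point `p ≠ a_j` of `f_j` (resp. `p ≠ b_j` of `g_j`). (The landed
`stub_chartNormalisation` is the same statement without the rows and the support clauses.) [folklore] -/
theorem chartNormalisation_structured :
    ∀ (m t : ℕ) (f g : Fin m → MvPolynomial (Fin 2) ℂ), (∀ j, (f j).support.card ≤ t) →
      (∀ j, (g j).support.card ≤ t) →
        ∀ a b : Fin m → Expo, Cancelling f g a b →
          ∃ r₁ r₂ : Fin 2 → ℤ, r₁ 0 * r₂ 1 ≠ r₁ 1 * r₂ 0 ∧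
          ∃ u v : Fin m → MvPolynomial (Fin 2) ℂ,
            (∀ j, coeff 0 (u j) = 0 ∧ (u j).support.card ≤ t - 1) ∧
            (∀ j, coeff 0 (v j) = 0 ∧ (v j).support.card ≤ t - 1) ∧
            (∀ j, ∀ d ∈ (u j).support, ∃ p ∈ (f j).support, p ≠ a j ∧
              ((d 0 : ℕ) : ℤ) = r₁ 0 * (((p 0 : ℕ) : ℤ) - (((a j) 0 : ℕ) : ℤ)) +
                r₁ 1 * (((p 1 : ℕ) : ℤ) - (((a j) 1 : ℕ) : ℤ)) ∧
              ((d 1 : ℕ) : ℤ) = r₂ 0 * (((p 0 : ℕ) : ℤ) - (((a j) 0 : ℕ) : ℤ)) +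
                r₂ 1 * (((p 1 : ℕ) : ℤ) - (((a j) 1 : ℕ) : ℤ))) ∧
            (∀ j, ∀ d ∈ (v j).support, ∃ p ∈ (g j).support, p ≠ b j ∧
              ((d 0 : ℕ) : ℤ) = r₁ 0 * (((p 0 : ℕ) : ℤ) - (((b j) 0 : ℕ) : ℤ)) +
                r₁ 1 * (((p 1 : ℕ) : ℤ) - (((b j) 1 : ℕ) : ℤ)) ∧
              ((d 1 : ℕ) : ℤ) = r₂ 0 * (((p 0 : ℕ) : ℤ) - (((b j) 0 : ℕ) : ℤ)) +
                r₂ 1 * (((p 1 : ℕ) : ℤ) - (((b j) 1 : ℕ) : ℤ))) ∧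
            (hidden f g a b).ncard ≤ (visible u v).ncard := by
  classical
  intro m t f g hf hg a b hcan
  by_cases hne : (hidden f g a b).Nonempty
  swap
  · refine ⟨![1, 0], ![0, 1], by norm_num, fun _ => 0, fun _ => 0, fun j => ⟨by simp, by simp⟩,
      fun j => ⟨by simp, by simp⟩, fun j d hd => ?_, fun j d hd => ?_, ?_⟩
    · simp at hd
    · simp at hd
    · rw [Set.not_nonempty_iff_eq_empty.mp hne, Set.ncard_empty]
      exact Nat.zero_le _
  obtain ⟨l₀, ξ₀, hfa, hgb, -⟩ := hne
  have ha : ∀ j, a j ∈ (f j).support := fun j => Finset.mem_coe.mp (hfa j).1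
  have hb : ∀ j, b j ∈ (g j).support := fun j => Finset.mem_coe.mp (hgb j).1
  -- Steps 1–2: an adapted integer chart
  obtain ⟨w, hwf, hwg⟩ := exists_int_form_of_tops f g a b ξ₀ hfa hgb
  obtain ⟨r₁, r₂, hdet, hAf, hAg⟩ := exists_adapted_rows f g a b w hwf hwg
  obtain ⟨L, hL0, hL1⟩ : ∃ L : Expo →+ (Fin 2 → ℤ),
      (∀ e, L e 0 = r₁ 0 * ((e 0 : ℕ) : ℤ) + r₁ 1 * ((e 1 : ℕ) : ℤ)) ∧
        ∀ e, L e 1 = r₂ 0 * ((e 0 : ℕ) : ℤ) + r₂ 1 * ((e 1 : ℕ) : ℤ) :=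
    ⟨AddMonoidHom.mk' (fun (e : Expo) (i : Fin 2) =>
        (![r₁, r₂] i) 0 * ((e 0 : ℕ) : ℤ) + (![r₁, r₂] i) 1 * ((e 1 : ℕ) : ℤ))
      (fun p q => funext fun i => by simp only [Finsupp.coe_add, Pi.add_apply, Nat.cast_add]; ring),
      fun _ => rfl, fun _ => rfl⟩
  have hLinj : Function.Injective L := fun p q h =>
    TwoProducts.ConeChart.cc_chart_injective r₁ r₂ hdet p q (by rw [← hL0, ← hL0, h]) (by rw [← hL1, ← hL1, h])
  have hAf' : ∀ j, ∀ p ∈ (f j).support, L (a j) ≤ L p := fun j p hp => by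
    rw [Pi.le_def, Fin.forall_fin_two, hL0, hL0, hL1, hL1]; exact hAf j p hp
  have hAg' : ∀ j, ∀ p ∈ (g j).support, L (b j) ≤ L p := fun j p hp => by
    rw [Pi.le_def, Fin.forall_fin_two, hL0, hL0, hL1, hL1]; exact hAg j p hp
  -- the local instance (constant terms `1`) and its tails
  obtain ⟨u', hu'⟩ : ∃ u' : Fin m → MvPolynomial (Fin 2) ℂ, ∀ j, u' j = ∑ p ∈ (f j).support,
      monomial (Finsupp.equivFunOnFinite.symm fun i => (L p i - L (a j) i).toNat)
        (coeff p (f j) / coeff (a j) (f j)) := ⟨_, fun _ => rfl⟩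
  obtain ⟨v', hv'⟩ : ∃ v' : Fin m → MvPolynomial (Fin 2) ℂ, ∀ j, v' j = ∑ p ∈ (g j).support,
      monomial (Finsupp.equivFunOnFinite.symm fun i => (L p i - L (b j) i).toNat)
        (coeff p (g j) / coeff (b j) (g j)) := ⟨_, fun _ => rfl⟩
  have hu0 : ∀ j, coeff 0 (u' j) = 1 := fun j =>
    (hu' j) ▸ TwoProducts.ConeChart.cc_local_coeff_zero L hLinj (f j) (a j) (ha j) (hAf' j)
  have hv0 : ∀ j, coeff 0 (v' j) = 1 := fun j =>
    (hv' j) ▸ TwoProducts.ConeChart.cc_local_coeff_zero L hLinj (g j) (b j) (hb j) (hAg' j)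
  -- tail monomials are charted relative tails
  have htailu : ∀ j, ∀ d ∈ (u' j - 1).support, ∃ p ∈ (f j).support, p ≠ a j ∧ L (a j) ≤ L p ∧
      d = Finsupp.equivFunOnFinite.symm fun i => (L p i - L (a j) i).toNat := by
    intro j d hd
    have hd' : d ∈ (u' j).support := by
      have h := support_sub _ _ _ hd
      rcases Finset.mem_union.mp h with h | h
      · exact h
      · exfalso
        rw [support_one, Finset.mem_singleton] at h
        subst h
        rw [mem_support_iff, coeff_sub, coeff_zero_one, hu0 j, sub_self] at hd
        exact hd rfl
    have hd0 : d ≠ 0 := by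
      rintro rfl
      rw [mem_support_iff, coeff_sub, coeff_zero_one, hu0 j, sub_self] at hd
      exact hd rfl
    rw [hu' j] at hd'
    obtain ⟨p, hp, rfl⟩ := exists_of_mem_support_local L (f j) (a j) _ hd'
    have hpa : p ≠ a j := by
      rintro rfl
      exact hd0 (TwoProducts.ConeChart.cc_psi_self L (a j))
    exact ⟨p, hp, hpa, hAf' j p hp, rfl⟩
  have htailv : ∀ j, ∀ d ∈ (v' j - 1).support, ∃ p ∈ (g j).support, p ≠ b j ∧ L (b j) ≤ L p ∧
      d = Finsupp.equivFunOnFinite.symm fun i => (L p i - L (b j) i).toNat := by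
    intro j d hd
    have hd' : d ∈ (v' j).support := by
      have h := support_sub _ _ _ hd
      rcases Finset.mem_union.mp h with h | h
      · exact h
      · exfalso
        rw [support_one, Finset.mem_singleton] at h
        subst h
        rw [mem_support_iff, coeff_sub, coeff_zero_one, hv0 j, sub_self] at hd
        exact hd rfl
    have hd0 : d ≠ 0 := by
      rintro rfl
      rw [mem_support_iff, coeff_sub, coeff_zero_one, hv0 j, sub_self] at hd
      exact hd rfl
    rw [hv' j] at hd'
    obtain ⟨p, hp, rfl⟩ := exists_of_mem_support_local L (g j) (b j) _ hd'
    have hpb : p ≠ b j := by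
      rintro rfl
      exact hd0 (TwoProducts.ConeChart.cc_psi_self L (b j))
    exact ⟨p, hp, hpb, hAg' j p hp, rfl⟩
  refine ⟨r₁, r₂, hdet, fun j => u' j - 1, fun j => v' j - 1,
    fun j => ⟨by rw [coeff_sub, coeff_zero_one, hu0 j, sub_self],
      card_support_sub_one_le (u' j) t ((hu' j) ▸ (TwoProducts.ConeChart.cc_local_card L (f j) (a j)).trans (hf j))
        (hu0 j)⟩,
    fun j => ⟨by rw [coeff_sub, coeff_zero_one, hv0 j, sub_self],
      card_support_sub_one_le (v' j) t ((hv' j) ▸ (TwoProducts.ConeChart.cc_local_card L (g j) (b j)).trans (hg j))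
        (hv0 j)⟩, fun j d hd => ?_, fun j d hd => ?_, ?_⟩
  · obtain ⟨p, hp, hpa, hle, rfl⟩ := htailu j d hd
    exact ⟨p, hp, hpa, psi_coord_eq L r₁ r₂ hL0 hL1 (a j) p hle⟩
  · obtain ⟨p, hp, hpb, hle, rfl⟩ := htailv j d hd
    exact ⟨p, hp, hpb, psi_coord_eq L r₁ r₂ hL0 hL1 (b j) p hle⟩
  -- the normalised difference is `∏ u' − ∏ v'`
  have htail : tailDiff (fun j => u' j - 1) (fun j => v' j - 1) = ∏ j, u' j - ∏ j, v' j := by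
    simp only [tailDiff, add_sub_cancel]
  set F := ∏ j, f j - ∏ j, g j with hF
  set D := ∏ j, u' j - ∏ j, v' j with hD
  obtain ⟨hMM, hcc⟩ := hcan
  have hc : ∏ j, coeff (a j) (f j) ≠ 0 := Finset.prod_ne_zero_iff.mpr fun j _ => mem_support_iff.mp (ha j)
  have hcoefD : ∀ e, L (∑ j, a j) ≤ L e →
      coeff (Finsupp.equivFunOnFinite.symm fun i => (L e i - L (∑ j, a j) i).toNat) D =
        coeff e F / ∏ j, coeff (a j) (f j) := by
    intro e he
    rw [hD, hF, coeff_sub, coeff_sub, sub_div, TwoProducts.ConeChart.cc_prod_local_coeff L hLinj f a hAf' u' hu' _ rfl e he,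
      TwoProducts.ConeChart.cc_prod_local_coeff L hLinj g b hAg' v' hv' _ hMM.symm e he, hcc]
  have hchart : ∀ d ∈ D.support, ∃ e, L (∑ j, a j) ≤ L e ∧
      d = Finsupp.equivFunOnFinite.symm fun i => (L e i - L (∑ j, a j) i).toNat := by
    intro d hd
    rcases Finset.mem_union.mp (support_sub _ _ _ hd) with h | h
    · exact TwoProducts.ConeChart.cc_prod_local_support L f a hAf' u' hu' _ rfl d h
    · exact TwoProducts.ConeChart.cc_prod_local_support L g b hAg' v' hv' _ hMM.symm d h
  have hFle : ∀ e ∈ F.support, L (∑ j, a j) ≤ L e := by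
    intro e he
    rcases Finset.mem_union.mp (support_sub _ _ _ he) with h | h
    · exact TwoProducts.ConeChart.cc_le_chart_of_mem_support L f a hAf' _ rfl e h
    · exact TwoProducts.ConeChart.cc_le_chart_of_mem_support L g b hAg' _ hMM.symm e h
  -- `Ψ` charts the hidden set injectively into the visible set
  show (hidden f g a b).ncard ≤ (visible (fun j => u' j - 1) (fun j => v' j - 1)).ncard
  unfold visible
  rw [htail]
  refine Set.ncard_le_ncard_of_injOn
    (fun e => Finsupp.equivFunOnFinite.symm fun i => (L e i - L (∑ j, a j) i).toNat) ?_ ?_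
    ((D.support.finite_toSet).subset fun d hd => ?_)
  · -- a hidden point with its realising weight `ξ` goes to a visible point with weight `ξ' = L^{-T} ξ`
    intro e he
    obtain ⟨ξ, hfa', hgb', heF, hemax⟩ := he
    have heF' : e ∈ F.support := Finset.mem_coe.mp heF
    obtain ⟨ξ', hξ'⟩ := exists_transport_weight r₁ r₂ hdet ξ
    refine ⟨ξ', ⟨fun j d hd => ?_, fun j d hd => ?_⟩, ?_, fun d hd hne => ?_⟩
    · obtain ⟨p, hp, hpa, hle, rfl⟩ := htailu j d hd
      rw [wt_psi L r₁ r₂ hL0 hL1 ξ ξ' hξ' (a j) p hle]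
      have hlt := (hfa' j).2 p (Finset.mem_coe.mpr hp) hpa
      linarith
    · obtain ⟨p, hp, hpb, hle, rfl⟩ := htailv j d hd
      rw [wt_psi L r₁ r₂ hL0 hL1 ξ ξ' hξ' (b j) p hle]
      have hlt := (hgb' j).2 p (Finset.mem_coe.mpr hp) hpb
      linarith
    · -- `Ψ e` lies in `supp D`
      refine Finset.mem_coe.mpr ?_
      rw [mem_support_iff, hcoefD e (hFle e heF')]
      exact div_ne_zero (mem_support_iff.mp heF') hc
    · -- every other point of `supp D` has smaller transported weight
      have hdD : d ∈ D.support := Finset.mem_coe.mp hd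
      obtain ⟨e₁, he₁, rfl⟩ := hchart d hdD
      have he₁F : e₁ ∈ F.support := by
        rw [mem_support_iff, hcoefD e₁ he₁] at hdD
        exact mem_support_iff.mpr fun h0 => hdD (by rw [h0, zero_div])
      have hlt := hemax e₁ (Finset.mem_coe.mpr he₁F) fun h => hne (by rw [h])
      rw [wt_psi L r₁ r₂ hL0 hL1 ξ ξ' hξ' _ e₁ he₁, wt_psi L r₁ r₂ hL0 hL1 ξ ξ' hξ' _ e (hFle e heF')]
      linarith
  · -- `Ψ` is injective on the hidden set
    intro e₁ h₁ e₂ h₂ hΨ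
    obtain ⟨-, -, -, h₁F, -⟩ := h₁
    obtain ⟨-, -, -, h₂F, -⟩ := h₂
    exact hLinj (TwoProducts.ConeChart.cc_psi_inj L _ e₁ e₂ (hFle e₁ (Finset.mem_coe.mp h₁F))
      (hFle e₂ (Finset.mem_coe.mp h₂F)) hΨ)
  · -- finiteness: visible points lie in `supp D`
    obtain ⟨_, -, hd, -⟩ := hd
    exact hd

end Summit.ValiantsHypothesis.ValiantsHypothesis.Theorems.NewtonUnitEquations.TwoProducts.FormalLogLinearisation

end
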